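import Summits.MatrixMultiplication.MatrixMultiplication.Theses.GelfandPairHosts
import Summits.MatrixMultiplication.MatrixMultiplication.Theorems.GelfandPairHostsGelfandHostingStubGelfandTrick
import Summits.MatrixMultiplication.MatrixMultiplication.Theorems.GelfandPairHostsGelfandHostingStubDesignOfSaturatedTriple
import Summits.MatrixMultiplication.MatrixMultiplication.Theorems.GelfandHosting.Negative.WreathF2

/-!
# `BeatTheSquares` (crux stmt-MatrixMultiplication-7383) — proved

Route `MatrixMultiplication/GelfandPairHosts`.  The crux asks for a multiplicity-free finite `G`-set with a
module-TPP design of size `(a,b,c)` and host cost `D = dim span{P_g} < abc` ("a module host beats the sum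
of the squares").  The witness is the line-`birth` machinery of the sibling crux `GelfandHosting` run on the
Cohn–Kleinberg–Szegedy–Umans wreath triple over `F₂`: `Negative/WreathF2.lean` gives a GENEROUSLY TRANSITIVE
host `(F₂⁴)³ ≀ C₂ ↷ ((F₂⁴)³)²` (`N = 2²⁴`, `|G| = 2²⁵ ≥ D`) with a stabiliser-saturated TPP triple of size
`|S|·|T|·|U•x₀| = 480·480·240 = 55 296 000 > 2²⁵`; the landed stubs `stub_gelfandTrick` (generous
transitivity ⇒ multiplicity-free) and `stub_designOfSaturatedTriple` (saturated TPP triple ⇒ module-TPP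
design of that size) turn it into the required design.  (The strategist seat
`planner-cstrat-stmt-MatrixMultiplication-7381-h1-0` first observed, with a kernel-checked candidate over
`ℤ/5`, that CKSU's triples are saturated and beat the squares; this file is an independent `F₂` version.)
-/

set_option linter.dupNamespace false

namespace Summit.MatrixMultiplication.MatrixMultiplication.Theorems

open Summit.MatrixMultiplication.MatrixMultiplication.Theses.GelfandPairHosts
open Summit.MatrixMultiplication.MatrixMultiplication.Theorems.GelfandHosting.Negative (wreathF2_beats)

/-- **`BeatTheSquares` holds**: the `F₂`-wreath host `(F₂⁴)³ ≀ C₂ ↷ ((F₂⁴)³)²` is multiplicity-free (Gelfand's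
trick on a generously transitive action) and carries a module-TPP design of size `(480, 480, 240)` (from the
saturated CKSU triple) while `D ≤ |G| = 2²⁵ < 55 296 000 = abc`.
[cite: CohnKleinbergSzegedyUmans2005, §2 Lemma 2.1 (= arXiv:math/0511460 Lemma 10)] -/
theorem beatTheSquares_proof : BeatTheSquares := by
  obtain ⟨G, iG, iF, X, iFX, iDX, iMA, x₀, S, T, U, hgt, htpp, hsat, hlt⟩ := wreathF2_beats
  obtain ⟨φ, ψ, χ, hdes⟩ := stub_designOfSaturatedTriple G X x₀ S T U htpp hsat
  exact ⟨G, iG, iF, X, iFX, iDX, iMA, _, _, _, φ, ψ, χ, stub_gelfandTrick G X hgt, hdes, hlt⟩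

end Summit.MatrixMultiplication.MatrixMultiplication.Theorems
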